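import Mathlib
import Literature.Computability.AlgebraicComplexity.PrattTrapezoidVal
import Summits.MatrixMultiplication.MatrixMultiplication.Theorems.EisensteinValCertificatesPrimeValSavingPointwiseLoads
import Summits.MatrixMultiplication.MatrixMultiplication.Theorems.EisensteinValCertificatesPrimeValSavingDisjointSquares

/-!
# The density threshold `1/2` in a general finite abelian group

Ninth support file of the series for route `MatrixMultiplication/EisensteinValCertificates` (cruxes
`stmt-MatrixMultiplication-7788` `PrimeValSaving`, stmt-7790 `PrimeFourThirdsSaving`), completing the
density picture: at PRIME modulus the three sets of an equilateral-trapezoid-free triple have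
`min(#A, #B, #C) ≤ (1/3 + o(1))p` (`PrattValPrimeThird`, sharp); in a GENERAL finite abelian group of
order `N` the sharp threshold is `1/2`:

* `card_mul_sq_le` : if `#A + #B ≥ N` then `#C·(#A + #B − N)² ≤ #A·#B` — every `C`-line carries at
  least `#A + #B − N` points (`PrattValDisjointSquares.card_add_card_le_card_A_through_C`) while
  `∑_c r(c)² ≤ #A·#B` (`sum_sq_C_le`);
* `min_mul_sq_le` : `min·(2·min − N)² ≤ N²` for `min = min(#A, #B, #C)`, so `min ≤ N/2 + √N`.

Sharpness: in `ℤ/2m` the triple `A = B = C =` odd residues has density `1/2` (no solutions of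
`a + b + c = 0`, vacuously trapezoid-free).  Only system 1 of Def. 3.2 is used.
[cite: Pratt2024, Def. 3.2, Prop. 3.1]
-/

-- single-conjunct summit: the mandated namespace repeats `MatrixMultiplication`.
set_option linter.dupNamespace false

namespace Summit.MatrixMultiplication.MatrixMultiplication.Theorems

namespace PrattValHalfDensity

open Finset Literature.Computability.AlgebraicComplexity PrattValPointwiseLoads PrattValDisjointSquares

variable {G : Type*} [AddCommGroup G] [DecidableEq G] [Fintype G] {A B C : Finset G}

/-- **Two large sets force the third to be tiny.** For a trapezoid-free triple in a finite abelian
group of order `N` with `#A + #B ≥ N`: `#C·(#A + #B − N)² ≤ #A·#B`. [cite: Pratt2024, Prop. 3.1] -/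
theorem card_mul_sq_le (h : IsEquilateralTrapezoidFree A B C) (hAB : Fintype.card G ≤ #A + #B) :
    #C * (#A + #B - Fintype.card G) ^ 2 ≤ #A * #B := by
  calc #C * (#A + #B - Fintype.card G) ^ 2
      = ∑ c ∈ C, (#A + #B - Fintype.card G) ^ 2 := by rw [sum_const, smul_eq_mul]
    _ ≤ ∑ c ∈ C, #(A.filter fun a => -(a + c) ∈ B) ^ 2 := by
        refine sum_le_sum fun c _ => Nat.pow_le_pow_left ?_ 2
        have := card_add_card_le_card_A_through_C A B c
        omega
    _ ≤ #A * #B := sum_sq_C_le h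

/-- **Density threshold `1/2`.** For a trapezoid-free triple in a finite abelian group of order `N`,
`m·(2m − N)² ≤ N²` where `m = min(#A, #B, #C)`; hence `m ≤ N/2 + √N` (and `m ≤ N/2` up to
`O(√N)` is sharp: the odd residues of `ℤ/2m`). [cite: Pratt2024, Def. 3.2] -/
theorem min_mul_sq_le (h : IsEquilateralTrapezoidFree A B C) :
    min (min #A #B) #C * (2 * min (min #A #B) #C - Fintype.card G) ^ 2 ≤ Fintype.card G ^ 2 := by
  set m := min (min #A #B) #C with hm
  set N := Fintype.card G with hN
  have hmA : m ≤ #A := (min_le_left _ _).trans (min_le_left _ _)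
  have hmB : m ≤ #B := (min_le_left _ _).trans (min_le_right _ _)
  have hmC : m ≤ #C := min_le_right _ _
  have hAN : #A ≤ N := card_le_univ _
  have hBN : #B ≤ N := card_le_univ _
  by_cases h2 : 2 * m ≤ N
  · rw [Nat.sub_eq_zero_of_le h2]; simp
  · rw [not_le] at h2
    have hAB : N ≤ #A + #B := by omega
    have key := card_mul_sq_le h hAB
    have h1 : 2 * m - N ≤ #A + #B - N := by omega
    calc m * (2 * m - N) ^ 2 ≤ #C * (#A + #B - N) ^ 2 :=
          Nat.mul_le_mul hmC (Nat.pow_le_pow_left h1 2)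
      _ ≤ #A * #B := key
      _ ≤ N * N := Nat.mul_le_mul hAN hBN
      _ = N ^ 2 := (sq N).symm

/-- **Density threshold `1/2` (readable form)**: `min(#A, #B, #C) ≤ N/2 + √N` for every
trapezoid-free triple in a finite abelian group of order `N`. [cite: Pratt2024, Def. 3.2] -/
theorem min_card_le_half (h : IsEquilateralTrapezoidFree A B C) :
    ((min (min #A #B) #C : ℕ) : ℝ) ≤ Fintype.card G / 2 + Real.sqrt (Fintype.card G) := by
  have key := min_mul_sq_le h
  set m := min (min #A #B) #C with hm
  set N := Fintype.card G with hN
  have hmN : m ≤ N := (min_le_right _ _).trans (card_le_univ _)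
  by_cases h2 : 2 * m ≤ N
  · have : (2 : ℝ) * m ≤ N := by exact_mod_cast h2
    have hs : 0 ≤ Real.sqrt N := Real.sqrt_nonneg _
    linarith
  · rw [not_le] at h2
    have hm0 : 0 < m := by omega
    -- `(2m − N)² ≤ N²/m ≤ 2N`, so `2m − N ≤ √(2N) ≤ 2√N`... we use `(2m - N)^2 * m ≤ N^2` and `m > N/2`
    have keyR : (m : ℝ) * ((2 * m - N : ℕ) : ℝ) ^ 2 ≤ (N : ℝ) ^ 2 := by exact_mod_cast key
    have hsub : ((2 * m - N : ℕ) : ℝ) = 2 * (m : ℝ) - N := by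
      rw [Nat.cast_sub h2.le]; push_cast; ring
    rw [hsub] at keyR
    have hmR : (N : ℝ) < 2 * m := by exact_mod_cast h2
    have hNR : (0 : ℝ) ≤ N := Nat.cast_nonneg _
    -- `(2m − N)² ≤ N²/m < 2N ≤ 4N`
    have hsq : (2 * (m : ℝ) - N) ^ 2 ≤ 4 * N := by
      by_contra hcon
      rw [not_le] at hcon
      have hmpos : (0 : ℝ) < m := by exact_mod_cast hm0
      -- m * (2m-N)^2 > m * 4N ≥ (N/2) * 4N = 2N² ≥ N², contradiction unless N = 0
      nlinarith [keyR, hcon, hmR, hNR, hmpos]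
    have h3 : 2 * (m : ℝ) - N ≤ 2 * Real.sqrt N := by
      have h4 : 2 * (m : ℝ) - N ≤ Real.sqrt (4 * N) := Real.le_sqrt_of_sq_le hsq
      rw [show (4 : ℝ) * N = 2 ^ 2 * N by norm_num, Real.sqrt_mul (by norm_num),
        Real.sqrt_sq (by norm_num)] at h4
      exact h4
    linarith

end PrattValHalfDensity

end Summit.MatrixMultiplication.MatrixMultiplication.Theorems
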